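/-
Copyright (c) 2026 the pub-hodgecm-mathlib formalisation cell (harness21).  Prover seat hodgecm-mathlib-LA7-p01 (g3), «GO 500» half A,
organ (S1) of A-p01 (g28)'s `stub_ESHEET` organ map, §3 LEG-1 of the (S8) cut (LA4-plan (g2)); 2026-09-02.
-/
import Literature.AlgebraicGeometry.AbelianSchemes.SerreTwistModuliTuple
import Literature.NumberTheory.NumberFields.SerreTensorPresentationOfIdeal
import Mathlib.NumberTheory.NumberField.CMField
import HarnessLib

/-!
# The Serre-twisted moduli tuple over `𝒪 = 𝓞 F` (`F` a CM field): the presentation, the Rosati pair and the (t2) guard discharged from the twist rows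
# ([RapoportSmithlingZhang2020Diagonal] §3.2 ∕ (4.23); [Shimura1998] §8.3 Prop. 29; [Conrad2004GrossZagier] §7 Thm. 7.5)

Topic `AlgebraicGeometry/AbelianSchemes`, namespace `Literature.AlgebraicGeometry.AbelianSchemes.AbelianSchemeOver`.  THEOREMS ONLY (no definition, no named
fact, no `instance`, no notation, no `sorry`); universe `0` (number fields live in `Type`).  Cell `hodgecm-mathlib` (D-0151), F0∕P6 «MOD», «GO 500» half A,
X-LEAF socket `stub_ESHEET`, (S8) closer cut (LA4-plan (g2) 2026-09-02 06:41Z, A-p01 (g28) «=» 06:45Z) **§3 LEG-1 «THE (S1) STACK AT `𝓞 F`»**: the capstone ★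
`exists_serreTwist_moduliTuple` (★ `SerreTwistModuliTuple`) re-keyed on the sheet line's own tokens — the E-tuple's ROSATI field (`ι(b̄) ≫ λ = λ ≫ ι(b)^∨`,
`Cruxes/HLiu418/Lines/F0_P6a_PELWitnessEDefs.lean` :373 shape) and the TWIST ROWS (a) `(ν) = 𝔞 · c•𝔞`, (b) `𝔞 + (n) = (1)`, (d) `𝔞 + c•𝔞 = (1)` of ★
`Theorems/F0P6aTwistData(Coprime)` — with the Serre presentation of `𝔞⁻¹` (★ `exists_serrePresentation_of_ideal_of_natCast_mem`), the Rosati pair and the (t2) guard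
CHOSEN∕DERIVED INSIDE; `--supports stmt-HodgeConjecture-24832`, count-neutral.  HONEST LABEL: HC_CM is proved only modulo the 7 printed citations (2 remaining:
hLiu418 = stmt-HodgeConjecture-24832, h413 = stmt-HodgeConjecture-24833) until rung 0 closes; this file discharges none of them.

## Mathematics

`c = IsCMField.complexConj F` acts on `𝓞 F` and on its ideals (Mathlib `MulSemiringAction` ∕ pointwise).  From (d) `𝔞 + c•𝔞 = (1)` pick `1 = x + y`, `x ∈ 𝔞`,
`y ∈ c•𝔞`; then `b := c⁻¹•y ∈ 𝔞`, `ȳ… = y = c•b`, so the Rosati field gives `ι(y) ≫ λ = λ ≫ ι(b)^∨` with `1 − y = x ∈ 𝔞`, `b ∈ 𝔞` — the ROSATI PAIR of ★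
`exists_isExactTwistPol_of_rosatiPair`; the Rosati LAW `ι(c•z) ≫ λ = λ ≫ ι(z)^∨` is the field at `(z, c•z)`.  From (a), `ν ∈ 𝔞·c•𝔞 ⊆ 𝔞`, so `𝔞⁻¹` has a Serre
presentation with scalar `ν` ([Conrad2004GrossZagier] §7); and for `y ∈ c•𝔞`, `x ∈ 𝔞`: `y·x ∈ 𝔞·c•𝔞 = (ν)` — the (t2) guard.  Everything else is ★
`exists_serreTwist_moduliTuple` verbatim (relDim, `HasType δ` and symplectic liftability through the hypotheses `hT`, `hsymp` — LA4-p05's heads —, the cover rows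
(t1)(t1′)(t2)(t3)(t4)(t5), the Rosati law of `λ′`, uniqueness), the dual pair of the twist being supplied by `hdual` for the chosen presentation.

* `exists_rosatiPair_of_sup_complexConj_smul_eq_top` — the Rosati pair from (d);
* `mul_mem_span_natCast_of_mem_of_span_eq_mul` — the (t2) guard from (a);
* `natCast_mem_of_span_eq_mul` — `ν ∈ 𝔞` from (a);
* **`exists_serreTwist_moduliTuple_of_isCMField`** — THE HEAD.

## References
* [RapoportSmithlingZhang2020Diagonal] M. Rapoport, B. Smithling, W. Zhang (2020), §3.2 (p. 11), §4.3 (4.23) (p. 21).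
* [Shimura1998] G. Shimura, *Abelian Varieties with Complex Multiplication and Modular Functions* (1998), §8.3 Prop. 29 (p. 63).
* [Conrad2004GrossZagier] B. Conrad, *Gross–Zagier revisited*, MSRI Publ. 49 (2004), §7 Thm. 7.5.
* [MumfordFogartyKirwan1994] D. Mumford, J. Fogarty, F. Kirwan, *Geometric Invariant Theory*, 3rd ed. (1994), Ch. 7 §2 Definition 7.2 (p. 129).
-/

set_option autoImplicit false

-- as the ★ Serre-tensor files: `Over`/`Scheme` wrappers and `Scheme.Modules` are semireducible
set_option backward.isDefEq.respectTransparency false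

noncomputable section

open CategoryTheory CategoryTheory.Limits AlgebraicGeometry MonoidalCategory CartesianMonoidalCategory
open NumberField
open scoped MonObj NumberField Pointwise

namespace Literature.AlgebraicGeometry.AbelianSchemes

namespace AbelianSchemeOver

/-! ## §1 Number-field bookkeeping: the Rosati pair from (d), the (t2) guard and `ν ∈ 𝔞` from (a) -/

section Bookkeeping

variable {F : Type} [Field F] [NumberField F] [IsCMField F]

/-- `b := c⁻¹ • y` has conjugate `y`: `((c • (c⁻¹ • y) : 𝓞 F) : F) = c (… : F)` and `c • c⁻¹ • y = y` (private helper). [folklore] -/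
private theorem coe_eq_complexConj_coe_inv_smul (y : 𝓞 F) :
    (y : F) = (IsCMField.complexConj F) (((IsCMField.complexConj F)⁻¹ • y : 𝓞 F) : F) := by
  have h : (IsCMField.complexConj F) • ((IsCMField.complexConj F)⁻¹ • y) = y := smul_inv_smul _ y
  conv_lhs => rw [← h]
  rfl

/-- **THE ROSATI PAIR FROM ROW (d)**: if `𝔞 + c•𝔞 = (1)` and the action satisfies the Rosati field `ι(b′) ≫ λ = λ ≫ ι(b)^∨` whenever `b′ = c b`, then there are
`a, b ∈ 𝓞 F` with `ι(a) ≫ λ = λ ≫ ι(b)^∨`, `1 − a ∈ 𝔞`, `b ∈ 𝔞` (the input of ★ `exists_isExactTwistPol_of_rosatiPair`).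
[cite: RapoportSmithlingZhang2020Diagonal, §3.2 (p. 11)] [cite: Shimura1998, §8.3 Prop. 29, p. 63] -/
theorem exists_rosatiPair_of_sup_complexConj_smul_eq_top {S : Scheme.{0}} {A : AbelianSchemeOver S} (act : A.RingAction (𝓞 F))
    {D : A.DualPair} (pol : A.Polarization D)
    (rosati : ∀ (b b' : 𝓞 F), (b' : F) = (IsCMField.complexConj F) (b : F) →
      haveI := act.isMonHom b
      act.i b' ≫ pol.lam = pol.lam ≫ DualPair.dualIsogenyOver (act.i b) D D)
    {𝔞 : Ideal (𝓞 F)} (hd : 𝔞 ⊔ (IsCMField.complexConj F) • 𝔞 = ⊤) :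
    ∃ a b : 𝓞 F, (haveI := act.isMonHom b; act.i a ≫ pol.lam = pol.lam ≫ DualPair.dualIsogenyOver (act.i b) D D) ∧ 1 - a ∈ 𝔞 ∧ b ∈ 𝔞 := by
  have h1 : (1 : 𝓞 F) ∈ 𝔞 ⊔ (IsCMField.complexConj F) • 𝔞 := by rw [hd]; exact Submodule.mem_top
  obtain ⟨x, hx, y, hy, hxy⟩ := Submodule.mem_sup.mp h1
  refine ⟨y, (IsCMField.complexConj F)⁻¹ • y, rosati _ _ (coe_eq_complexConj_coe_inv_smul y), ?_,
    Ideal.mem_pointwise_smul_iff_inv_smul_mem.mp hy⟩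
  have hx' : 1 - y = x := by rw [← hxy]; ring
  rw [hx']
  exact hx

omit [NumberField F] [IsCMField F] in
/-- **THE (t2) GUARD FROM ROW (a)**: if `(ν) = 𝔞 · 𝔞′` then every `y ∈ 𝔞′` satisfies `y · x ∈ (ν)` for all `x ∈ 𝔞`. [cite: Conrad2004GrossZagier, §7 (Thm. 7.5)] -/
theorem mul_mem_span_natCast_of_mem_of_span_eq_mul {𝔞 𝔞' : Ideal (𝓞 F)} {ν : ℕ} (ha : Ideal.span {((ν : ℕ) : 𝓞 F)} = 𝔞 * 𝔞')
    {y : 𝓞 F} (hy : y ∈ 𝔞') (x : 𝓞 F) (hx : x ∈ 𝔞) : y * x ∈ Ideal.span {((ν : ℕ) : 𝓞 F)} := by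
  rw [ha, mul_comm y x]
  exact Ideal.mul_mem_mul hx hy

omit [NumberField F] [IsCMField F] in
/-- **`ν ∈ 𝔞` FROM ROW (a)**: `(ν) = 𝔞 · 𝔞′ ≤ 𝔞`. [cite: Conrad2004GrossZagier, §7 (Thm. 7.5)] -/
theorem natCast_mem_of_span_eq_mul {𝔞 𝔞' : Ideal (𝓞 F)} {ν : ℕ} (ha : Ideal.span {((ν : ℕ) : 𝓞 F)} = 𝔞 * 𝔞') :
    ((ν : ℕ) : 𝓞 F) ∈ 𝔞 :=
  Ideal.mul_le_right (ha ▸ Ideal.mem_span_singleton_self _)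

end Bookkeeping

/-! ## §2 The head: the (S1) capstone at `𝒪 = 𝓞 F` -/

section Head

variable {F : Type} [Field F] [NumberField F] [IsCMField F]
  {S : Scheme.{0}} [IsReduced S] [IsLocallyNoetherian S] {A : AbelianSchemeOver S} (act : A.RingAction (𝓞 F)) [IsCommMonObj A.X]
  (D : A.DualPair) (hD : Nonempty ((Scheme.Modules.pullback (DualPair.unitHatSlice D)).obj D.P ≅ SheafOfModules.unit _))
  (pol : A.Polarization D)

include hD in
/-- **THE SERRE-TWISTED MODULI TUPLE OVER `𝓞 F`** (`F` a CM field; base `S → Spec Fᵢ`, `char Fᵢ = 0`, reduced and locally Noetherian).  INPUT: the `𝓞 F`-action with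
the E-tuple's Rosati field; `A` of relative dimension `g` with a level-`n` structure `η`; an integral ideal `𝔞` and `ν ≠ 0` with the twist rows (a)
`(ν) = 𝔞 · c•𝔞`, (b)′ `(ν, n) = 1`, (d) `𝔞 + c•𝔞 = (1)`; a dual-pair source `hdual` for the Serre twists of `A`; and the two transports `hT` (type `δ`) ∕ `hsymp`
(symplectic) along `ψ_P`, quantified over the presentation (the shapes of ★ `Polarization.hasType_serreTwist_of_count` and of the (m4) head).  OUTPUT: a Serre
presentation `(E′, P, Q, ν)` of `𝔞⁻¹` (coordinates of `P` generating `𝔞`), a dual pair `D_𝔟` of `A ⊗ 𝔟` with its unit pin, a polarisation `polB` and a level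
structure `η′` with EVERY field of `(A ⊗ 𝔞⁻¹, D_𝔟, λ_𝔞, η_𝔞) ∈ 𝒜_{g,δ,n}(S)` and the cover rows for `c := ψ_P` — (t2) now for `y ∈ c•𝔞` as in `CoverE`, (t3) with `[ν]`.
[cite: RapoportSmithlingZhang2020Diagonal, §3.2 (p. 11) and §4.3 (4.23) (p. 21)] [cite: MumfordFogartyKirwan1994, Ch. 7 §2 Definition 7.2 (p. 129)]
[cite: Conrad2004GrossZagier, §7 (Thm. 7.5)] -/
theorem exists_serreTwist_moduliTuple_of_isCMField {Fi : Type} [Field Fi] [CharZero Fi] (f : S ⟶ Spec (.of Fi))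
    (rosati : ∀ (b b' : 𝓞 F), (b' : F) = (IsCMField.complexConj F) (b : F) →
      haveI := act.isMonHom b
      act.i b' ≫ pol.lam = pol.lam ≫ DualPair.dualIsogenyOver (act.i b) D D)
    {g n : ℕ} {δ : Fin g → ℕ} (hA : A.IsOfRelDim g) (lvl : A.LevelStructure g n)
    {𝔞 : Ideal (𝓞 F)} (h𝔞 : 𝔞 ≠ ⊥) {ν : ℕ} (hν : ν ≠ 0)
    (hrow_a : Ideal.span {((ν : ℕ) : 𝓞 F)} = 𝔞 * (IsCMField.complexConj F) • 𝔞) (hcop : Nat.Coprime ν n)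
    (hrow_d : 𝔞 ⊔ (IsCMField.complexConj F) • 𝔞 = ⊤)
    (hdual : ∀ {m : ℕ} (E' : Matrix (Fin m) (Fin m) (𝓞 F)) (hE' : E' * E' = E'),
      ∃ Db : (serreTensor act E' hE').DualPair,
        Nonempty ((Scheme.Modules.pullback (DualPair.unitHatSlice Db)).obj Db.P ≅ SheafOfModules.unit _))
    (hT : ∀ {m : ℕ} (E' : Matrix (Fin m) (Fin m) (𝓞 F)) (hE' : E' * E' = E') (P : Matrix (Fin m) (Fin 1) (𝓞 F)) (Q : Matrix (Fin 1) (Fin m) (𝓞 F)),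
      E' * P = P → Q * E' = Q → Q * P = Matrix.scalar (Fin 1) ((ν : ℕ) : 𝓞 F) → P * Q = Matrix.scalar (Fin m) ((ν : ℕ) : 𝓞 F) * E' →
      Ideal.span (Set.range fun k => P k 0) = 𝔞 →
      ∀ (Db : (serreTensor act E' hE').DualPair)
        (_ : Nonempty ((Scheme.Modules.pullback (DualPair.unitHatSlice Db)).obj Db.P ≅ SheafOfModules.unit _))
        (polB : (serreTensor act E' hE').Polarization Db), IsExactTwistPol act E' hE' P D Db pol ν polB.lam → polB.HasType δ)
    (hsymp : ∀ {m : ℕ} (E' : Matrix (Fin m) (Fin m) (𝓞 F)) (hE' : E' * E' = E') (P : Matrix (Fin m) (Fin 1) (𝓞 F)) (Q : Matrix (Fin 1) (Fin m) (𝓞 F)),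
      E' * P = P → Q * E' = Q → Q * P = Matrix.scalar (Fin 1) ((ν : ℕ) : 𝓞 F) → P * Q = Matrix.scalar (Fin m) ((ν : ℕ) : 𝓞 F) * E' →
      Ideal.span (Set.range fun k => P k 0) = 𝔞 →
      ∀ (Db : (serreTensor act E' hE').DualPair)
        (_ : Nonempty ((Scheme.Modules.pullback (DualPair.unitHatSlice Db)).obj Db.P ≅ SheafOfModules.unit _))
        (polB : (serreTensor act E' hE').Polarization Db) (lvl' : (serreTensor act E' hE').LevelStructure g n),
        IsExactTwistPol act E' hE' P D Db pol ν polB.lam → (∀ i, lvl'.σ i = lvl.σ i ≫ serreTranslate act E' hE' P) →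
          lvl'.IsSymplecticLiftable polB δ) :
    ∃ (m : ℕ) (E' : Matrix (Fin m) (Fin m) (𝓞 F)) (hE' : E' * E' = E') (P : Matrix (Fin m) (Fin 1) (𝓞 F)) (Q : Matrix (Fin 1) (Fin m) (𝓞 F))
      (Db : (serreTensor act E' hE').DualPair)
      (hDb : Nonempty ((Scheme.Modules.pullback (DualPair.unitHatSlice Db)).obj Db.P ≅ SheafOfModules.unit _))
      (polB : (serreTensor act E' hE').Polarization Db) (lvl' : (serreTensor act E' hE').LevelStructure g n),
      -- the presentation of `𝔞⁻¹` with scalar `ν`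
      E' * P = P ∧ Q * E' = Q ∧ Q * P = Matrix.scalar (Fin 1) ((ν : ℕ) : 𝓞 F) ∧ P * Q = Matrix.scalar (Fin m) ((ν : ℕ) : 𝓞 F) * E' ∧
      Ideal.span (Set.range fun k => P k 0) = 𝔞 ∧
      -- the moduli fields
      (serreTensor act E' hE').IsOfRelDim g ∧ polB.HasType δ ∧ lvl'.IsSymplecticLiftable polB δ ∧
      -- (t1)
      (∀ x ∈ 𝔞, ∃ d : (serreTensor act E' hE').X ⟶ A.X, IsMonHom d ∧
        serreTranslate act E' hE' P ≫ d = act.i x ∧ d ≫ serreTranslate act E' hE' P = (serreAction act E' hE').i x) ∧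
      -- (t1′) + surjectivity
      (∀ ⦃T : Over S⦄ (t : T ⟶ A.X), t ≫ serreTranslate act E' hE' P = 1 ↔ ∀ x ∈ 𝔞, t ≫ act.i x = 1) ∧
      Function.Surjective (serreTranslate act E' hE' P).left.base ∧
      -- (t2) through `c•𝔞` and `(ν) = 𝔞·c•𝔞`
      (∀ y ∈ (IsCMField.complexConj F) • 𝔞, ∃ f : A.X ⟶ (serreTensor act E' hE').X, IsMonHom f ∧
        serreTranslate act E' hE' P ≫ (serreAction act E' hE').i y = f ≫ (serreAction act E' hE').i ((ν : ℕ) : 𝓞 F)) ∧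
      -- (t3)
      (haveI := isMonHom_serreTranslate act E' hE' P
       serreTranslate act E' hE' P ≫ polB.lam ≫ DualPair.dualIsogenyOver (serreTranslate act E' hE' P) D Db = pol.lam ≫ D.hat.mulN ν) ∧
      -- (t4)
      (∀ x : 𝓞 F, act.i x ≫ serreTranslate act E' hE' P = serreTranslate act E' hE' P ≫ (serreAction act E' hE').i x) ∧
      -- (t5)
      (∀ i, lvl'.σ i = lvl.σ i ≫ serreTranslate act E' hE' P) ∧
      (∀ c : Fin g ⊕ Fin g → ZMod n, lvl'.section_ c = lvl.section_ c ≫ serreTranslate act E' hE' P) ∧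
      -- Rosati law of `λ′`
      (∀ x : 𝓞 F, (serreAction act E' hE').i ((IsCMField.complexConj F) • x) ≫ polB.lam =
        polB.lam ≫ ((serreAction act E' hE').dual Db hDb).i x) ∧
      -- uniqueness
      (∀ lam'' : (serreTensor act E' hE').X ⟶ Db.hat.X, IsMonHom lam'' →
        (haveI := isMonHom_serreTranslate act E' hE' P
         serreTranslate act E' hE' P ≫ lam'' ≫ DualPair.dualIsogenyOver (serreTranslate act E' hE' P) D Db = pol.lam ≫ D.hat.mulN ν) →
        lam'' = polB.lam) := by
  -- the presentation of `𝔞⁻¹` with scalar `ν ∈ 𝔞`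
  have hνmem : ((ν : ℕ) : 𝓞 F) ∈ 𝔞 := natCast_mem_of_span_eq_mul hrow_a
  obtain ⟨m, E', hE', P, Q, hP, hQ, hQP, hPQ, hspan, -, -⟩ :=
    Literature.NumberTheory.NumberFields.SerrePresentation.exists_serrePresentation_of_ideal_of_natCast_mem 𝔞 h𝔞 hνmem
  -- the dual pair of the twist
  obtain ⟨Db, hDb⟩ := hdual E' hE'
  -- the Rosati pair from (d) and the Rosati law from the field
  obtain ⟨a, b, hab, ha, hb⟩ := exists_rosatiPair_of_sup_complexConj_smul_eq_top act pol rosati hrow_d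
  have hlam : ∀ x : 𝓞 F, act.i ((IsCMField.complexConj F) • x) ≫ pol.lam = pol.lam ≫ (act.dual D hD).i x :=
    fun x => rosati x _ rfl
  -- the capstone
  obtain ⟨polB, lvl', hrel, hTB, hs, ht1, ht1', hsurj, ht2, ht3, ht4, ht5, ht5', hros, huniq⟩ :=
    exists_serreTwist_moduliTuple act E' hE' P Q D Db hD hDb pol (fun x => (IsCMField.complexConj F) • x) f hν hP hQ hQP hPQ hspan hab ha hb
      hlam hA lvl hcop (fun polB hex => hT E' hE' P Q hP hQ hQP hPQ hspan Db hDb polB hex)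
      (fun polB lvl' hex h5 => hsymp E' hE' P Q hP hQ hQP hPQ hspan Db hDb polB lvl' hex h5)
  refine ⟨m, E', hE', P, Q, Db, hDb, polB, lvl', hP, hQ, hQP, hPQ, hspan, hrel, hTB, hs, ht1, ht1', hsurj, ?_, ht3, ht4, ht5, ht5', hros, huniq⟩
  -- (t2): `y ∈ c•𝔞` gives `y·x ∈ (ν)` for all `x ∈ 𝔞` by (a)
  intro y hy
  exact ht2 y (fun x hx => mul_mem_span_natCast_of_mem_of_span_eq_mul hrow_a hy x hx)

/-! ## §3 (ED. 2, add-only) The head with the PRESENTATION-INDEXED dual source (LA6-p02 (g2) (M1) finding #1) -/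

include hD in
/-- **(ED. 2) THE SERRE-TWISTED MODULI TUPLE OVER `𝓞 F` — PRESENTATION-INDEXED DUAL SOURCE** (LA6-p02 (g2) 2026-09-02 (M1) census finding #1: the
dual pair is asked only for the Serre twist by the CHOSEN presentation `(E′, P, Q, ν)` of `𝔞⁻¹`, the binder shape of ★ `exists_serreTensor_dualPair_unit`;
otherwise token-identical to `exists_serreTwist_moduliTuple_of_isCMField`).  ORIGINAL: **THE SERRE-TWISTED MODULI TUPLE OVER `𝓞 F`** (`F` a CM field; base `S → Spec Fᵢ`, `char Fᵢ = 0`, reduced and locally Noetherian).  INPUT: the `𝓞 F`-action with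
the E-tuple's Rosati field; `A` of relative dimension `g` with a level-`n` structure `η`; an integral ideal `𝔞` and `ν ≠ 0` with the twist rows (a)
`(ν) = 𝔞 · c•𝔞`, (b)′ `(ν, n) = 1`, (d) `𝔞 + c•𝔞 = (1)`; a dual-pair source `hdual` for the Serre twists of `A`; and the two transports `hT` (type `δ`) ∕ `hsymp`
(symplectic) along `ψ_P`, quantified over the presentation (the shapes of ★ `Polarization.hasType_serreTwist_of_count` and of the (m4) head).  OUTPUT: a Serre
presentation `(E′, P, Q, ν)` of `𝔞⁻¹` (coordinates of `P` generating `𝔞`), a dual pair `D_𝔟` of `A ⊗ 𝔟` with its unit pin, a polarisation `polB` and a level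
structure `η′` with EVERY field of `(A ⊗ 𝔞⁻¹, D_𝔟, λ_𝔞, η_𝔞) ∈ 𝒜_{g,δ,n}(S)` and the cover rows for `c := ψ_P` — (t2) now for `y ∈ c•𝔞` as in `CoverE`, (t3) with `[ν]`.
[cite: RapoportSmithlingZhang2020Diagonal, §3.2 (p. 11) and §4.3 (4.23) (p. 21)] [cite: MumfordFogartyKirwan1994, Ch. 7 §2 Definition 7.2 (p. 129)]
[cite: Conrad2004GrossZagier, §7 (Thm. 7.5)] -/
theorem exists_serreTwist_moduliTuple_of_isCMField' {Fi : Type} [Field Fi] [CharZero Fi] (f : S ⟶ Spec (.of Fi))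
    (rosati : ∀ (b b' : 𝓞 F), (b' : F) = (IsCMField.complexConj F) (b : F) →
      haveI := act.isMonHom b
      act.i b' ≫ pol.lam = pol.lam ≫ DualPair.dualIsogenyOver (act.i b) D D)
    {g n : ℕ} {δ : Fin g → ℕ} (hA : A.IsOfRelDim g) (lvl : A.LevelStructure g n)
    {𝔞 : Ideal (𝓞 F)} (h𝔞 : 𝔞 ≠ ⊥) {ν : ℕ} (hν : ν ≠ 0)
    (hrow_a : Ideal.span {((ν : ℕ) : 𝓞 F)} = 𝔞 * (IsCMField.complexConj F) • 𝔞) (hcop : Nat.Coprime ν n)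
    (hrow_d : 𝔞 ⊔ (IsCMField.complexConj F) • 𝔞 = ⊤)
    (hdual : ∀ {m : ℕ} (E' : Matrix (Fin m) (Fin m) (𝓞 F)) (hE' : E' * E' = E') (P : Matrix (Fin m) (Fin 1) (𝓞 F)) (Q : Matrix (Fin 1) (Fin m) (𝓞 F)),
      E' * P = P → Q * E' = Q → Q * P = Matrix.scalar (Fin 1) ((ν : ℕ) : 𝓞 F) → P * Q = Matrix.scalar (Fin m) ((ν : ℕ) : 𝓞 F) * E' →
      Ideal.span (Set.range fun k => P k 0) = 𝔞 →
      ∃ Db : (serreTensor act E' hE').DualPair,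
        Nonempty ((Scheme.Modules.pullback (DualPair.unitHatSlice Db)).obj Db.P ≅ SheafOfModules.unit _))
    (hT : ∀ {m : ℕ} (E' : Matrix (Fin m) (Fin m) (𝓞 F)) (hE' : E' * E' = E') (P : Matrix (Fin m) (Fin 1) (𝓞 F)) (Q : Matrix (Fin 1) (Fin m) (𝓞 F)),
      E' * P = P → Q * E' = Q → Q * P = Matrix.scalar (Fin 1) ((ν : ℕ) : 𝓞 F) → P * Q = Matrix.scalar (Fin m) ((ν : ℕ) : 𝓞 F) * E' →
      Ideal.span (Set.range fun k => P k 0) = 𝔞 →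
      ∀ (Db : (serreTensor act E' hE').DualPair)
        (_ : Nonempty ((Scheme.Modules.pullback (DualPair.unitHatSlice Db)).obj Db.P ≅ SheafOfModules.unit _))
        (polB : (serreTensor act E' hE').Polarization Db), IsExactTwistPol act E' hE' P D Db pol ν polB.lam → polB.HasType δ)
    (hsymp : ∀ {m : ℕ} (E' : Matrix (Fin m) (Fin m) (𝓞 F)) (hE' : E' * E' = E') (P : Matrix (Fin m) (Fin 1) (𝓞 F)) (Q : Matrix (Fin 1) (Fin m) (𝓞 F)),
      E' * P = P → Q * E' = Q → Q * P = Matrix.scalar (Fin 1) ((ν : ℕ) : 𝓞 F) → P * Q = Matrix.scalar (Fin m) ((ν : ℕ) : 𝓞 F) * E' →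
      Ideal.span (Set.range fun k => P k 0) = 𝔞 →
      ∀ (Db : (serreTensor act E' hE').DualPair)
        (_ : Nonempty ((Scheme.Modules.pullback (DualPair.unitHatSlice Db)).obj Db.P ≅ SheafOfModules.unit _))
        (polB : (serreTensor act E' hE').Polarization Db) (lvl' : (serreTensor act E' hE').LevelStructure g n),
        IsExactTwistPol act E' hE' P D Db pol ν polB.lam → (∀ i, lvl'.σ i = lvl.σ i ≫ serreTranslate act E' hE' P) →
          lvl'.IsSymplecticLiftable polB δ) :
    ∃ (m : ℕ) (E' : Matrix (Fin m) (Fin m) (𝓞 F)) (hE' : E' * E' = E') (P : Matrix (Fin m) (Fin 1) (𝓞 F)) (Q : Matrix (Fin 1) (Fin m) (𝓞 F))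
      (Db : (serreTensor act E' hE').DualPair)
      (hDb : Nonempty ((Scheme.Modules.pullback (DualPair.unitHatSlice Db)).obj Db.P ≅ SheafOfModules.unit _))
      (polB : (serreTensor act E' hE').Polarization Db) (lvl' : (serreTensor act E' hE').LevelStructure g n),
      -- the presentation of `𝔞⁻¹` with scalar `ν`
      E' * P = P ∧ Q * E' = Q ∧ Q * P = Matrix.scalar (Fin 1) ((ν : ℕ) : 𝓞 F) ∧ P * Q = Matrix.scalar (Fin m) ((ν : ℕ) : 𝓞 F) * E' ∧
      Ideal.span (Set.range fun k => P k 0) = 𝔞 ∧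
      -- the moduli fields
      (serreTensor act E' hE').IsOfRelDim g ∧ polB.HasType δ ∧ lvl'.IsSymplecticLiftable polB δ ∧
      -- (t1)
      (∀ x ∈ 𝔞, ∃ d : (serreTensor act E' hE').X ⟶ A.X, IsMonHom d ∧
        serreTranslate act E' hE' P ≫ d = act.i x ∧ d ≫ serreTranslate act E' hE' P = (serreAction act E' hE').i x) ∧
      -- (t1′) + surjectivity
      (∀ ⦃T : Over S⦄ (t : T ⟶ A.X), t ≫ serreTranslate act E' hE' P = 1 ↔ ∀ x ∈ 𝔞, t ≫ act.i x = 1) ∧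
      Function.Surjective (serreTranslate act E' hE' P).left.base ∧
      -- (t2) through `c•𝔞` and `(ν) = 𝔞·c•𝔞`
      (∀ y ∈ (IsCMField.complexConj F) • 𝔞, ∃ f : A.X ⟶ (serreTensor act E' hE').X, IsMonHom f ∧
        serreTranslate act E' hE' P ≫ (serreAction act E' hE').i y = f ≫ (serreAction act E' hE').i ((ν : ℕ) : 𝓞 F)) ∧
      -- (t3)
      (haveI := isMonHom_serreTranslate act E' hE' P
       serreTranslate act E' hE' P ≫ polB.lam ≫ DualPair.dualIsogenyOver (serreTranslate act E' hE' P) D Db = pol.lam ≫ D.hat.mulN ν) ∧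
      -- (t4)
      (∀ x : 𝓞 F, act.i x ≫ serreTranslate act E' hE' P = serreTranslate act E' hE' P ≫ (serreAction act E' hE').i x) ∧
      -- (t5)
      (∀ i, lvl'.σ i = lvl.σ i ≫ serreTranslate act E' hE' P) ∧
      (∀ c : Fin g ⊕ Fin g → ZMod n, lvl'.section_ c = lvl.section_ c ≫ serreTranslate act E' hE' P) ∧
      -- Rosati law of `λ′`
      (∀ x : 𝓞 F, (serreAction act E' hE').i ((IsCMField.complexConj F) • x) ≫ polB.lam =
        polB.lam ≫ ((serreAction act E' hE').dual Db hDb).i x) ∧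
      -- uniqueness
      (∀ lam'' : (serreTensor act E' hE').X ⟶ Db.hat.X, IsMonHom lam'' →
        (haveI := isMonHom_serreTranslate act E' hE' P
         serreTranslate act E' hE' P ≫ lam'' ≫ DualPair.dualIsogenyOver (serreTranslate act E' hE' P) D Db = pol.lam ≫ D.hat.mulN ν) →
        lam'' = polB.lam) := by
  -- the presentation of `𝔞⁻¹` with scalar `ν ∈ 𝔞`
  have hνmem : ((ν : ℕ) : 𝓞 F) ∈ 𝔞 := natCast_mem_of_span_eq_mul hrow_a
  obtain ⟨m, E', hE', P, Q, hP, hQ, hQP, hPQ, hspan, -, -⟩ :=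
    Literature.NumberTheory.NumberFields.SerrePresentation.exists_serrePresentation_of_ideal_of_natCast_mem 𝔞 h𝔞 hνmem
  -- the dual pair of the twist
  obtain ⟨Db, hDb⟩ := hdual E' hE' P Q hP hQ hQP hPQ hspan
  -- the Rosati pair from (d) and the Rosati law from the field
  obtain ⟨a, b, hab, ha, hb⟩ := exists_rosatiPair_of_sup_complexConj_smul_eq_top act pol rosati hrow_d
  have hlam : ∀ x : 𝓞 F, act.i ((IsCMField.complexConj F) • x) ≫ pol.lam = pol.lam ≫ (act.dual D hD).i x :=
    fun x => rosati x _ rfl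
  -- the capstone
  obtain ⟨polB, lvl', hrel, hTB, hs, ht1, ht1', hsurj, ht2, ht3, ht4, ht5, ht5', hros, huniq⟩ :=
    exists_serreTwist_moduliTuple act E' hE' P Q D Db hD hDb pol (fun x => (IsCMField.complexConj F) • x) f hν hP hQ hQP hPQ hspan hab ha hb
      hlam hA lvl hcop (fun polB hex => hT E' hE' P Q hP hQ hQP hPQ hspan Db hDb polB hex)
      (fun polB lvl' hex h5 => hsymp E' hE' P Q hP hQ hQP hPQ hspan Db hDb polB lvl' hex h5)
  refine ⟨m, E', hE', P, Q, Db, hDb, polB, lvl', hP, hQ, hQP, hPQ, hspan, hrel, hTB, hs, ht1, ht1', hsurj, ?_, ht3, ht4, ht5, ht5', hros, huniq⟩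
  -- (t2): `y ∈ c•𝔞` gives `y·x ∈ (ν)` for all `x ∈ 𝔞` by (a)
  intro y hy
  exact ht2 y (fun x hx => mul_mem_span_natCast_of_mem_of_span_eq_mul hrow_a hy x hx)

end Head

end AbelianSchemeOver

end Literature.AlgebraicGeometry.AbelianSchemes

end
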